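import Literature.Geometry.Lorentzian.Sweep2
import Literature.Geometry.Lorentzian.BlackHoles

/-!
# Corrected vocabulary for stubs 1/3 of line `polynomial-closure` (drefute stmt-FinalStateConjecture-10606)

The tree's gr.S27 consequence form (`Kerr.IsAdmissibleTeukolskyField`, `Kerr.teukolskyEnergy`) lives
on the OPEN exterior `{r > r₊}` with Cauchy data compactly supported in the OPEN slice
`{t* = 0, r > r₊}`. As a HYPOTHESIS of the nonlinear transfer (stub 3) this is the wrong black box:
no bound transfers to horizon-crossing data (closed-subspace obstruction, see the stub note), while
the crux's data live on `Kerr.slice a M = {t* = 0, r > M} ⊋ {r ≥ r₊}`. Below: the same objects on the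
horizon-PENETRATING chart `Kerr.region a r₀` (`r₀ < r₊`; canonical `r₀ := M`, where the local red-shift
`(r − M)/(r² + a²)` changes sign), with the Teukolsky equation imposed only off the axis AND off
`{Δ = 0}` (the coefficients of `Kerr.blRadialVector` / Teukolsky (4.7) carry `Δ⁻¹`, junk-zero at
`r = r₊` under `x/0 = 0`), and smoothness across `H⁺` demanded of the horizon-REGULAR rescaled
tensorised field `α̃ m_s ⊗ m_s` (DHR's `α̃^{[±2]}`), not of `α`.
-/

noncomputable section

namespace DrefuteCorrected

open Literature.Geometry.Lorentzian Literature.Geometry.Lorentzian.Kerr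
open scoped Manifold ContDiff ENNReal
open Set MeasureTheory

/-- Complex `□_g` of the Kerr metric `Kerr.metric M a r₀` on the chart domain `Kerr.region a r₀`. -/
def cdalembertianOn [Facts] (M a r₀ : ℝ) [(metric M a r₀).HasLeviCivita] (α : region a r₀ → ℂ)
    (x : region a r₀) : ℂ :=
  ((metric M a r₀).toPseudoRiemannianMetric.dalembertian (fun y ↦ (α y).re) x : ℂ) +
    Complex.I * ((metric M a r₀).toPseudoRiemannianMetric.dalembertian (fun y ↦ (α y).im) x : ℂ)

/-- Teukolsky's operator (4.7) in the form `ρ² □_g +` first order, verbatim `Kerr.teukolskyOp` but on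
`Kerr.region a r₀`. Junk on the axis and on `{Δ = 0}` (never imposed there). -/
def teukolskyOpOn [Facts] (M a r₀ : ℝ) [(metric M a r₀).HasLeviCivita] (s : ℤ)
    (α : region a r₀ → ℂ) (x : region a r₀) : ℂ :=
  ((radius a x.1 ^ 2 + a ^ 2 * cosTheta a x.1 ^ 2 : ℝ) : ℂ) * cdalembertianOn M a r₀ α x +
    2 * (s : ℂ) * ((radius a x.1 - M : ℝ) : ℂ) * coordDeriv α x.1 (blRadialVector M a x.1) +
    2 * (s : ℂ) * (((a * (radius a x.1 - M) / delta M a (radius a x.1) : ℝ) : ℂ) +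
        Complex.I * ((cosTheta a x.1 / sinTheta a x.1 ^ 2 : ℝ) : ℂ)) *
      coordDeriv α x.1 (blAxialVector x.1) +
    2 * (s : ℂ) * (((M * (radius a x.1 ^ 2 - a ^ 2) / delta M a (radius a x.1) - radius a x.1
          : ℝ) : ℂ) - Complex.I * ((a * cosTheta a x.1 : ℝ) : ℂ)) *
      coordDeriv α x.1 (E4.basisVector 0) +
    ((s : ℂ) - (s : ℂ) ^ 2 * ((cosTheta a x.1 ^ 2 / sinTheta a x.1 ^ 2 : ℝ) : ℂ)) * α x

/-- **Admissible spin-`s` Teukolsky fields on the horizon-penetrating chart `{r > r₀}`** (`r₀ < r₊`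
intended): the horizon-regular rescaled tensorised field `α̃ m_s ⊗ m_s` extends to a `C^∞` tensor
field `T` on the whole chart (across the axis AND across `H⁺ = {Δ = 0}`), the Cauchy data of `T` on
`{t* = 0, r > r₀}` are compactly supported in that OPEN slice — the support may STRADDLE the horizon
sphere `{r = r₊}` — and `α` solves Teukolsky off the axis and off `{Δ = 0}`. -/
def IsAdmissibleTeukolskyFieldOn [Facts] (M a r₀ : ℝ) [(metric M a r₀).HasLeviCivita] (s : ℤ)
    (α : region a r₀ → ℂ) : Prop :=
  (∃ T : region a r₀ → Fin 4 → Fin 4 → ℂ,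
      ContMDiff 𝓘(ℝ, E4) 𝓘(ℝ, Fin 4 → Fin 4 → ℂ) ∞ T ∧
        (∀ x : region a r₀, x.1 ∉ axis → delta M a (radius a x.1) ≠ 0 →
          T x = tensorise a s (rescale M a s α) x) ∧
        ∃ K : Set (region a r₀), IsCompact K ∧
          ∀ x : region a r₀, (x : E4) 0 = 0 → x ∉ K →
            T x = 0 ∧ mfderiv 𝓘(ℝ, E4) 𝓘(ℝ, Fin 4 → Fin 4 → ℂ) T x = 0) ∧
    ∀ x : region a r₀, x.1 ∉ axis → delta M a (radius a x.1) ≠ 0 → teukolskyOpOn M a r₀ s α x = 0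

/-- Weighted `k`-th order energy of `α̃ m_s ⊗ m_s` through `{t* = τ} ∩ {r > r₀} ∩ {y ∈ A}`. -/
def teukolskyEnergyOn (M a r₀ : ℝ) (s : ℤ) (α : region a r₀ → ℂ) (τ : ℝ) (k : ℕ) (p : ℝ)
    (A : Set E3) : ℝ≥0∞ :=
  sliceSobolevEnergy (region a r₀) (tensorise a s (rescale M a s α)) τ k p A

/-- **Corrected linear law at one spin** (homogeneous, horizon-penetrating): stub 1′ / hypothesis of
stub 3′ use it with `r₀ := M` (the crux's own chart `Kerr.region a M ⊇ Kerr.slice a M`). -/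
def TeukolskyLawOn [Facts] (M a r₀ : ℝ) (k : ℕ) (w R Λ : ℝ) : Prop :=
  ∀ [(metric M a r₀).HasLeviCivita], ∀ spin : ℤ, (spin = 2 ∨ spin = -2) →
    ∀ α : region a r₀ → ℂ, IsAdmissibleTeukolskyFieldOn M a r₀ spin α →
      (∀ τ : ℝ, 0 ≤ τ →
        teukolskyEnergyOn M a r₀ spin α τ 1 0 (Metric.closedBall 0 R) ≤
          ENNReal.ofReal Λ * teukolskyEnergyOn M a r₀ spin α 0 k w univ) ∧
      ∫⁻ τ in Ioi (0 : ℝ), teukolskyEnergyOn M a r₀ spin α τ 1 0 (Metric.closedBall 0 R) ≤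
        ENNReal.ofReal Λ * teukolskyEnergyOn M a r₀ spin α 0 k w univ

/-- **Inhomogeneous (DHRT (1.3)-format) variant**: sources `F`, equation `𝔗 α = F` off axis/`{Δ=0}`,
source norm = time-integrated weighted `k`-th order energy of the (rescaled, tensorised) source. -/
def IsAdmissibleTeukolskyPairOn [Facts] (M a r₀ : ℝ) [(metric M a r₀).HasLeviCivita] (s : ℤ)
    (α F : region a r₀ → ℂ) : Prop :=
  (∃ T : region a r₀ → Fin 4 → Fin 4 → ℂ,
      ContMDiff 𝓘(ℝ, E4) 𝓘(ℝ, Fin 4 → Fin 4 → ℂ) ∞ T ∧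
        (∀ x : region a r₀, x.1 ∉ axis → delta M a (radius a x.1) ≠ 0 →
          T x = tensorise a s (rescale M a s α) x) ∧
        ∃ K : Set (region a r₀), IsCompact K ∧
          ∀ x : region a r₀, (x : E4) 0 = 0 → x ∉ K →
            T x = 0 ∧ mfderiv 𝓘(ℝ, E4) 𝓘(ℝ, Fin 4 → Fin 4 → ℂ) T x = 0) ∧
    (∃ S : region a r₀ → Fin 4 → Fin 4 → ℂ, ContMDiff 𝓘(ℝ, E4) 𝓘(ℝ, Fin 4 → Fin 4 → ℂ) ∞ S ∧
      ∀ x : region a r₀, x.1 ∉ axis → delta M a (radius a x.1) ≠ 0 →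
        S x = tensorise a s (rescale M a s F) x) ∧
    ∀ x : region a r₀, x.1 ∉ axis → delta M a (radius a x.1) ≠ 0 → teukolskyOpOn M a r₀ s α x = F x

def TeukolskyInhomLawOn [Facts] (M a r₀ : ℝ) (k : ℕ) (w R Λ : ℝ) : Prop :=
  ∀ [(metric M a r₀).HasLeviCivita], ∀ spin : ℤ, (spin = 2 ∨ spin = -2) →
    ∀ α F : region a r₀ → ℂ, IsAdmissibleTeukolskyPairOn M a r₀ spin α F →
      (∀ τ : ℝ, 0 ≤ τ →
        teukolskyEnergyOn M a r₀ spin α τ 1 0 (Metric.closedBall 0 R) ≤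
          ENNReal.ofReal Λ * (teukolskyEnergyOn M a r₀ spin α 0 k w univ +
            ∫⁻ σ in Ioi (0 : ℝ), teukolskyEnergyOn M a r₀ spin F σ k w univ)) ∧
      ∫⁻ τ in Ioi (0 : ℝ), teukolskyEnergyOn M a r₀ spin α τ 1 0 (Metric.closedBall 0 R) ≤
        ENNReal.ofReal Λ * (teukolskyEnergyOn M a r₀ spin α 0 k w univ +
          ∫⁻ σ in Ioi (0 : ℝ), teukolskyEnergyOn M a r₀ spin F σ k w univ)

/-- Stub 1′ (`C⁺` retyped): κ-polynomial law on the crux's chart `r₀ = M`. -/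
def KappaPolynomialTeukolskyLawOn : Prop :=
  ∀ [Facts], ∃ a₁ : ℝ, a₁ < 1 ∧ ∃ (p : ℝ) (k : ℕ) (w : ℝ), 0 ≤ p ∧
    ∀ M : ℝ, 0 < M → ∀ R : ℝ, ∃ C : ℝ, 1 ≤ C ∧ ∀ a : ℝ, a₁ * M ≤ |a| →
      IsSubextremal M a → TeukolskyInhomLawOn M a M k w R (C * (1 - (a / M) ^ 2) ^ (-p))

/-- Sanity: the corrected class is non-empty (zero field). -/
example [Facts] (M a r₀ : ℝ) [(metric M a r₀).HasLeviCivita] (s : ℤ) :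
    IsAdmissibleTeukolskyFieldOn M a r₀ s (fun _ ↦ 0) := by
  refine ⟨⟨fun _ ↦ 0, contMDiff_const, fun x _ _ ↦ ?_, ∅, isCompact_empty, fun x _ _ ↦
    ⟨rfl, mfderiv_const⟩⟩, fun x _ _ ↦ ?_⟩
  · simp [rescale_zero]
  · have h0 : Function.extend (Subtype.val : region a r₀ → E4) (fun _ ↦ (0 : ℂ)) (0 : E4 → ℂ)
        = 0 := by
      funext y
      classical
      rw [Function.extend_def]
      split_ifs <;> rfl
    simp [teukolskyOpOn, cdalembertianOn, coordDeriv, h0,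
      PseudoRiemannianMetric.dalembertian_const]

/-- Sanity: its energies vanish, so `TeukolskyLawOn M a r₀ k w R Λ` is consistent for `Λ ≥ 0`. -/
example (M a r₀ : ℝ) (s : ℤ) (τ : ℝ) (k : ℕ) (p : ℝ) (A : Set E3) :
    teukolskyEnergyOn M a r₀ s (fun _ ↦ 0) τ k p A = 0 := by
  simp [teukolskyEnergyOn]

end DrefuteCorrected

end
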